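import Summits.ValiantsHypothesis.ValiantsHypothesis.Theorems.KPlusLogSqLawTropicalBHessenbergBlocks

/-!
# Route «KPlusLogSqLaw», crux `TropicalB` (stmt-ValiantsHypothesis-19771) — `TropicalB` ON THE HESSENBERG SECTOR, all formats,
# with an absolute constant (Gusfield's divide and conquer; the first rung of the crux beyond slope counting)

HONEST FRAMING.  A SECTOR theorem toward the registered stubs `stub_tropThin` / `stub_tropFat` of
`Cruxes/TropicalB/Lines/birth.lean` (crux `TropicalB`, item stmt-ValiantsHypothesis-19771, route KPlusLogSqLaw, DRAFT; seat
val-sym-trop-p5, desk docket D1(b)).  It proves the statement of `TropicalB` — `n ≤ 2^{C (K + ⌊log₂ m⌋²)}` for every signed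
(indeed every unsigned) dominant chain — for designs with HESSENBERG support (`IsHessenberg ε`: entry `(a, b)` carries a class
only if `a ≤ b + 1`), for ALL `(m, K)` with `C = 30`, i.e. IN THE WINDOW `log₂ m + 1 < K < m` as well.  This sector
contains the staircase / Carstensen–Mulmuley–Shah–Gajjar–Radhakrishnan path families (every super-polynomial lower-bound family
the route knows), and slope counting is useless on it (`2^{m−1}·K^m` present terms).  Nothing is claimed for general supports:
`TropicalB` in the window stays OPEN; nothing here bears on `MatrixDescartes` (stmt-ValiantsHypothesis-18050) or VP ≠ VNP.

THE ARGUMENT (Gusfield 1980's `n^{O(log n)}` bound for parametric shortest paths, in the dominance vocabulary; part 4 of 4 after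
`…IntervalOptDefs` / `…IntervalOpt` (toolkit, sub-additivity) / `…HessenbergBlocks` (structure lemmas)).  A present term of a Hessenberg design is a permutation with `σ i ≤ i + 1`, i.e. a
product of consecutive cycles (BLOCKS `x → x+1 → ⋯ → y → x`), with a class on each entry.  For a column interval `I = [a, c)`
let `V(I)` be the set of restrictions to `I` of terms `p`, stable on `I`, that are RESTRICTED OPTIMA on `I` at some integer
slope (`IntervalOpt.optRestr`).  (1) `stable_or_cross`, `exists_block`: if `I` is stable for `p`, every cut `t ∈ (a, c)`
is either a block boundary (`[a, t)` stable) or crossed by a subdiagonal entry (`σ (t−1) = t`); hence the block `[x, y]`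
of `p` containing the midpoint `t₀ = a + ⌊(c−a)/2⌋` splits `I = [a, x) ⊔ [x, y] ⊔ [y+1, c)` with `[a, x)`, `[y+1, c)`
stable of length `≤ ⌊(c−a)/2⌋`.  (2) `card_optRestr_ico_step`: grouping `V(I)` by `(x, y)` (`≤ (c−a)²` pairs) and applying
SUB-ADDITIVITY (`IntervalOpt.card_optRestr_union_le`) twice and the block bound `≤ (y−x+1)(mK+1) + 1`
(`card_optRestr_block_le`, sub-additivity down to single columns) gives
`#V(I) ≤ (c−a)² · (2 · max #V(piece) + (c−a)(mK+1) + 1)`, whence (3) `card_optRestr_ico_le`: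
`#V([a,c)) ≤ (mK+3) · 2^{5(⌊log₂ (c−a)⌋+1)²}` by strong induction.  (4) `designRowD_hessenberg`, `tropicalB_hessenberg`: a dominant chain
with distinct consecutive terms injects into `V([0, m))` (`chain_le_card_optRestr`), so `n + 1 ≤ (mK+3)·2^{5(⌊log₂ m⌋+1)²}`
and `n ≤ 2^{30 (K + ⌊log₂ m⌋²)}`.

[folklore] D. Gusfield, Sensitivity analysis for combinatorial optimization, PhD thesis, UC Berkeley (1980) (upper bound
`n^{O(log n)}` for parametric shortest paths); P. Carstensen, Math. Programming 26 (1983) 64–75 (matching lower bound).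
-/

set_option linter.dupNamespace false
set_option autoImplicit false

namespace Summit.ValiantsHypothesis.ValiantsHypothesis.Theorems.KPlusLogSqLaw

open Summit.ValiantsHypothesis.ValiantsHypothesis.Theorems.MatrixDescartes.Negative
open Summit.ValiantsHypothesis.ValiantsHypothesis.Theorems.LacunarySymmetroidMatrixDescartes
open scoped BigOperators
open Finset

namespace IntervalOpt

variable {m K : ℕ} {d : Fin K → ℕ} {v ε : Fin m → Fin m → Fin K → ℤ}

/-! ## 1. Counting: blocks, the recursion step, the solved recursion -/

/-- a block contributes at most `w·(mK+1) + 1` optimal restrictions on its first `w` columns (sub-additivity down to single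
columns). [folklore] -/
theorem card_optRestr_block_le (x y : ℕ) :
    ∀ w : ℕ, x + w ≤ y + 1 →
      (optRestr d v ε (ico m x (x + w)) (fun p => Stable (ico m x (y + 1)) p ∧ IsBlock x y p)).card ≤
        w * (m * K + 1) + 1 := by
  intro w
  induction w with
  | zero =>
    intro _
    have he : ico m x (x + 0) = ∅ := ico_eq_empty (by omega)
    have h := card_optRestr_le_one_of_empty (d := d) (v := v) (ε := ε) he
      (fun p => Stable (ico m x (y + 1)) p ∧ IsBlock x y p)
    omega
  | succ w ih =>
    intro hw
    have hsplit : ico m x (x + (w + 1)) = ico m x (x + w) ∪ ico m (x + w) (x + w + 1) := by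
      rw [← Nat.add_assoc]
      exact ico_union (by omega) (by omega)
    rw [hsplit]
    have hsub1 : ico m x (x + w) ⊆ ico m x (y + 1) := by
      intro i hi; rw [mem_ico] at hi ⊢; omega
    have hsub2 : ico m (x + w) (x + w + 1) ⊆ ico m x (y + 1) := by
      intro i hi; rw [mem_ico] at hi ⊢; omega
    have step := card_optRestr_union_le (d := d) (v := v) (ε := ε)
      (J₁ := ico m x (x + w)) (J₂ := ico m (x + w) (x + w + 1))
      (Q := fun p => Stable (ico m x (y + 1)) p ∧ IsBlock x y p)
      (Q₁ := fun p => Stable (ico m x (y + 1)) p ∧ IsBlock x y p)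
      (Q₂ := fun p => Stable (ico m x (y + 1)) p ∧ IsBlock x y p)
      (fun _ h => h) (fun _ h => h)
      (fun p p' h h' => image_eq_image_of_block hsub1 h.2 h'.2)
      (fun p p' h h' => image_eq_image_of_block hsub2 h.2 h'.2)
    have hat := card_optRestr_le_of_card_le_one (d := d) (v := v) (ε := ε) (card_ico_succ_le (x + w))
      (fun p => Stable (ico m x (y + 1)) p ∧ IsBlock x y p)
    have hih := ih (by omega)
    calc _ ≤ _ := step
      _ ≤ (w * (m * K + 1) + 1) + (m * K + 1) := Nat.add_le_add hih hat
      _ = (w + 1) * (m * K + 1) + 1 := by ring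

/-- **Recursion step.**  For a Hessenberg design, a stable interval `[a, c)` of length `ℓ = c − a ≥ 1` has at most
`ℓ² · (2G + ℓ(mK+1) + 1)` optimal stable restrictions, where `G` bounds the stable pieces of length `≤ ⌊ℓ/2⌋`. [folklore] -/
theorem card_optRestr_ico_step (hH : IsHessenberg ε) {a c : ℕ} (hac : a < c) (G : ℕ)
    (hG : ∀ a' c', a' ≤ c' → c' - a' ≤ (c - a) / 2 →
      (optRestr d v ε (ico m a' c') (fun p => Stable (ico m a' c') p)).card ≤ G) :
    (optRestr d v ε (ico m a c) (fun p => Stable (ico m a c) p)).card ≤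
      (c - a) ^ 2 * (2 * G + (c - a) * (m * K + 1) + 1) := by
  classical
  set t₀ := a + (c - a) / 2 with ht₀
  have hat : a ≤ t₀ := by omega
  have htc : t₀ < c := by omega
  -- the predicate selecting the block `[x, y]` through `t₀`
  set Qxy : ℕ × ℕ → (Equiv.Perm (Fin m) × (Fin m → Fin K)) → Prop := fun xy p =>
    Stable (ico m a c) p ∧ Stable (ico m a xy.1) p ∧ Stable (ico m a (xy.2 + 1)) p ∧ IsBlock xy.1 xy.2 p with hQxy
  set pairs := (Finset.Icc a t₀) ×ˢ (Finset.Ico t₀ c) with hpairs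
  -- (i) every optimal stable restriction has a block through `t₀`
  have hcover : optRestr d v ε (ico m a c) (fun p => Stable (ico m a c) p) ⊆
      pairs.biUnion fun xy => optRestr d v ε (ico m a c) (Qxy xy) := by
    intro r hr
    obtain ⟨p, θ, hst, hopt, rfl⟩ := mem_optRestr.1 hr
    obtain ⟨x, y, hax, hxt, hty, hyc, hsx, hsy, hblk⟩ :=
      exists_block (row_le_of_present hH hopt.1) hst t₀ hat htc
    refine Finset.mem_biUnion.2 ⟨(x, y), ?_, mem_optRestr.2 ⟨p, θ, ⟨hst, hsx, hsy, hblk⟩, hopt, rfl⟩⟩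
    rw [hpairs, Finset.mem_product, Finset.mem_Icc, Finset.mem_Ico]
    exact ⟨⟨hax, hxt⟩, hty, hyc⟩
  -- (ii) each group is bounded by sub-additivity
  have hgroup : ∀ xy ∈ pairs, (optRestr d v ε (ico m a c) (Qxy xy)).card ≤ 2 * G + (c - a) * (m * K + 1) + 1 := by
    rintro ⟨x, y⟩ hxy
    rw [hpairs, Finset.mem_product, Finset.mem_Icc, Finset.mem_Ico] at hxy
    obtain ⟨⟨hax, hxt⟩, hty, hyc⟩ := hxy
    -- first split: `[a, c) = [a, x) ∪ [x, c)`
    have e1 : ico m a c = ico m a x ∪ ico m x c := ico_union hax (by omega)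
    have s1 := card_optRestr_union_le (d := d) (v := v) (ε := ε) (J₁ := ico m a x) (J₂ := ico m x c)
      (Q := Qxy (x, y)) (Q₁ := fun p => Stable (ico m a x) p)
      (Q₂ := fun p => Stable (ico m x (y + 1)) p ∧ IsBlock x y p ∧ Stable (ico m (y + 1) c) p)
      (fun p h => h.2.1)
      (fun p h => ⟨stable_ico_of_stable hax h.2.1 h.2.2.1, h.2.2.2,
        stable_ico_of_stable (by omega) h.2.2.1 h.1⟩)
      (fun p p' h h' => image_eq_image_of_stable h h')
      (fun p p' h h' => by
        have hu : ico m x c = ico m x (y + 1) ∪ ico m (y + 1) c := ico_union (by omega) (by omega)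
        rw [hu]
        exact image_eq_image_of_stable (stable_union h.1 h.2.2) (stable_union h'.1 h'.2.2))
    -- second split: `[x, c) = [x, y+1) ∪ [y+1, c)`
    have e2 : ico m x c = ico m x (y + 1) ∪ ico m (y + 1) c := ico_union (by omega) (by omega)
    have s2 := card_optRestr_union_le (d := d) (v := v) (ε := ε) (J₁ := ico m x (y + 1)) (J₂ := ico m (y + 1) c)
      (Q := fun p => Stable (ico m x (y + 1)) p ∧ IsBlock x y p ∧ Stable (ico m (y + 1) c) p)
      (Q₁ := fun p => Stable (ico m x (y + 1)) p ∧ IsBlock x y p)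
      (Q₂ := fun p => Stable (ico m (y + 1) c) p)
      (fun p h => ⟨h.1, h.2.1⟩) (fun p h => h.2.2)
      (fun p p' h h' => image_eq_image_of_stable h.1 h'.1)
      (fun p p' h h' => image_eq_image_of_stable h h')
    -- the three pieces
    have hL : (optRestr d v ε (ico m a x) (fun p => Stable (ico m a x) p)).card ≤ G := hG a x hax (by omega)
    have hR : (optRestr d v ε (ico m (y + 1) c) (fun p => Stable (ico m (y + 1) c) p)).card ≤ G :=
      hG (y + 1) c (by omega) (by omega)
    have hB := card_optRestr_block_le (d := d) (v := v) (ε := ε) x y (y + 1 - x) (by omega)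
    have exw : x + (y + 1 - x) = y + 1 := by omega
    rw [exw] at hB
    have hw : (y + 1 - x) * (m * K + 1) ≤ (c - a) * (m * K + 1) := Nat.mul_le_mul_right _ (by omega)
    rw [e1]
    refine s1.trans ?_
    rw [e2]
    calc _ ≤ G + ((optRestr d v ε (ico m x (y + 1)) (fun p => Stable (ico m x (y + 1)) p ∧ IsBlock x y p)).card +
          (optRestr d v ε (ico m (y + 1) c) (fun p => Stable (ico m (y + 1) c) p)).card) := Nat.add_le_add hL s2
      _ ≤ G + (((y + 1 - x) * (m * K + 1) + 1) + G) := by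
          refine Nat.add_le_add_left (Nat.add_le_add hB hR) _
      _ ≤ 2 * G + (c - a) * (m * K + 1) + 1 := by omega
  -- (iii) the number of groups
  have hpc : pairs.card ≤ (c - a) ^ 2 := by
    rw [hpairs, Finset.card_product, Nat.card_Icc, Nat.card_Ico, sq]
    exact Nat.mul_le_mul (by omega) (by omega)
  calc (optRestr d v ε (ico m a c) (fun p => Stable (ico m a c) p)).card
      ≤ (pairs.biUnion fun xy => optRestr d v ε (ico m a c) (Qxy xy)).card := Finset.card_le_card hcover
    _ ≤ ∑ xy ∈ pairs, (optRestr d v ε (ico m a c) (Qxy xy)).card := Finset.card_biUnion_le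
    _ ≤ ∑ _xy ∈ pairs, (2 * G + (c - a) * (m * K + 1) + 1) := Finset.sum_le_sum hgroup
    _ = pairs.card * (2 * G + (c - a) * (m * K + 1) + 1) := by rw [Finset.sum_const, smul_eq_mul]
    _ ≤ (c - a) ^ 2 * (2 * G + (c - a) * (m * K + 1) + 1) := Nat.mul_le_mul_right _ hpc

/-- **Gusfield's recursion, solved.**  For a Hessenberg design, a stable column interval of length `≤ ℓ` has at most
`(mK + 3) · 2^{5 (⌊log₂ ℓ⌋ + 1)²}` optimal stable restrictions. [folklore] -/
theorem card_optRestr_ico_le (hH : IsHessenberg ε) (ℓ : ℕ) :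
    ∀ a c : ℕ, a ≤ c → c - a ≤ ℓ →
      (optRestr d v ε (ico m a c) (fun p => Stable (ico m a c) p)).card ≤
        (m * K + 3) * 2 ^ (5 * (Nat.log 2 ℓ + 1) ^ 2) := by
  induction ℓ using Nat.strong_induction_on with
  | _ ℓ ih =>
    intro a c hac hl
    set M := m * K + 1 with hM
    have hM3 : m * K + 3 = M + 2 := by omega
    rw [hM3]
    have hbig : 1 ≤ 2 ^ (5 * (Nat.log 2 ℓ + 1) ^ 2) := Nat.one_le_two_pow
    rcases Nat.eq_zero_or_pos (c - a) with h0 | hpos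
    · -- empty interval
      calc _ ≤ 1 := card_optRestr_le_one_of_empty (ico_eq_empty (by omega)) _
        _ ≤ (M + 2) * 2 ^ (5 * (Nat.log 2 ℓ + 1) ^ 2) := by nlinarith
    rcases Nat.lt_or_ge ℓ 2 with hsmall | hbig2
    · -- `ℓ = 1`: the pieces are empty
      have hl1 : c - a = 1 := by omega
      have step := card_optRestr_ico_step (d := d) (v := v) hH (show a < c by omega) 1
        (fun a' c' hle hlen => card_optRestr_le_one_of_empty (ico_eq_empty (by omega)) _)
      rw [hl1] at step
      have hlog : Nat.log 2 ℓ = 0 := Nat.log_of_lt (by omega)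
      rw [hlog]
      calc _ ≤ 1 ^ 2 * (2 * 1 + 1 * (m * K + 1) + 1) := step
        _ = M + 3 := by rw [hM]; ring
        _ ≤ (M + 2) * 2 ^ (5 * (0 + 1) ^ 2) := by norm_num; omega
    · -- `ℓ ≥ 2`: recurse on the pieces of length `≤ ⌊ℓ/2⌋`
      set L := Nat.log 2 ℓ with hL
      have hL1 : 1 ≤ L := Nat.le_log_of_pow_le one_lt_two (by omega)
      have hlt : ℓ < 2 ^ (L + 1) := Nat.lt_pow_succ_log_self one_lt_two _
      have hhalf : Nat.log 2 (ℓ / 2) + 1 = L := by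
        rw [Nat.log_div_base]; omega
      set G := (M + 2) * 2 ^ (5 * L ^ 2) with hG
      have step := card_optRestr_ico_step (d := d) (v := v) hH (show a < c by omega) G
        (fun a' c' hle hlen => by
          have h := ih (ℓ / 2) (by omega) a' c' hle (by omega)
          rwa [hhalf, hM3] at h)
      -- arithmetic: `(c-a)² (2G + (c-a) M + 1) ≤ (M+2) 2^{5(L+1)²}`
      have e0 : (c - a) ^ 2 * (2 * G + (c - a) * M + 1) ≤ ℓ ^ 2 * (2 * G + ℓ * M + 1) := by
        have h1 : (c - a) ^ 2 ≤ ℓ ^ 2 := Nat.pow_le_pow_left hl 2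
        have h2 : (c - a) * M ≤ ℓ * M := Nat.mul_le_mul_right _ hl
        exact Nat.mul_le_mul h1 (by omega)
      have e1 : ℓ ^ 2 ≤ 2 ^ (2 * L + 2) := by
        have h := Nat.pow_le_pow_left hlt.le 2
        rw [← pow_mul] at h
        calc ℓ ^ 2 ≤ 2 ^ ((L + 1) * 2) := h
          _ = 2 ^ (2 * L + 2) := by ring_nf
      have e2 : L + 1 ≤ 5 * L ^ 2 + 1 := by nlinarith
      have e3 : 2 ^ (L + 1) ≤ 2 ^ (5 * L ^ 2 + 1) := Nat.pow_le_pow_right (by norm_num) e2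
      have e4 : ℓ * M + 1 ≤ (M + 2) * 2 ^ (5 * L ^ 2 + 1) := by
        have h1 : ℓ * M ≤ 2 ^ (L + 1) * M := Nat.mul_le_mul_right _ hlt.le
        have h2 : 1 ≤ 2 ^ (L + 1) := Nat.one_le_two_pow
        calc ℓ * M + 1 ≤ 2 ^ (L + 1) * M + 2 ^ (L + 1) * 2 := by nlinarith
          _ = (M + 2) * 2 ^ (L + 1) := by ring
          _ ≤ (M + 2) * 2 ^ (5 * L ^ 2 + 1) := Nat.mul_le_mul_left _ e3
      have e5 : 2 * G + ℓ * M + 1 ≤ (M + 2) * 2 ^ (5 * L ^ 2 + 2) := by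
        have h1 : 2 * G = (M + 2) * 2 ^ (5 * L ^ 2 + 1) := by rw [hG, pow_succ]; ring
        have hsum : (M + 2) * 2 ^ (5 * L ^ 2 + 1) + (M + 2) * 2 ^ (5 * L ^ 2 + 1) =
            (M + 2) * 2 ^ (5 * L ^ 2 + 2) := by rw [pow_succ, pow_succ]; ring
        linarith
      have e6 : 2 * L + 2 + (5 * L ^ 2 + 2) ≤ 5 * (L + 1) ^ 2 := by nlinarith
      calc _ ≤ (c - a) ^ 2 * (2 * G + (c - a) * M + 1) := step
        _ ≤ ℓ ^ 2 * (2 * G + ℓ * M + 1) := e0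
        _ ≤ 2 ^ (2 * L + 2) * ((M + 2) * 2 ^ (5 * L ^ 2 + 2)) := Nat.mul_le_mul e1 e5
        _ = (M + 2) * 2 ^ (2 * L + 2 + (5 * L ^ 2 + 2)) := by rw [pow_add]; ring
        _ ≤ (M + 2) * 2 ^ (5 * (L + 1) ^ 2) := Nat.mul_le_mul_left _ (Nat.pow_le_pow_right (by norm_num) e6)

/-! ## 2. The sector theorem -/

/-- **`TropicalB` on the Hessenberg sector, unsigned form.**  For a Hessenberg design of format `(m, K)`, every chain of
dominant terms at strictly increasing integer slopes with distinct consecutive terms has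
`n + 1 ≤ (mK + 3) · 2^{5 (⌊log₂ m⌋ + 1)²}` terms. [folklore: Gusfield 1980] -/
theorem chain_le_hessenberg (hH : IsHessenberg ε) {n : ℕ} (θ : Fin (n + 1) → ℤ)
    (p : Fin (n + 1) → Equiv.Perm (Fin m) × (Fin m → Fin K)) (hθ : StrictMono θ)
    (hdom : ∀ k, IsDominant d v ε (θ k) (p k)) (hne : ∀ k : Fin n, p k.castSucc ≠ p k.succ) :
    n + 1 ≤ (m * K + 3) * 2 ^ (5 * (Nat.log 2 m + 1) ^ 2) := by
  have hinj := injective_of_chainD d v ε θ p hθ hdom hne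
  have h1 := chain_le_card_optRestr (d := d) (v := v) (ε := ε) θ p hinj hdom
    (fun q => Stable (ico m 0 m) q) (fun k => by rw [ico_univ]; exact stable_univ _)
  rw [← ico_univ] at h1
  have h2 := card_optRestr_ico_le (d := d) (v := v) hH m 0 m (Nat.zero_le _) (by omega)
  exact h1.trans h2

/-- exponent bookkeeping: `(mK + 3)·2^{5(L+1)²} ≤ 2^{30 (K + L²)}` for `K ≥ 1`, `m < 2^{L+1}`. [folklore] -/
theorem size_le_two_pow (m K : ℕ) (hK : 1 ≤ K) :
    (m * K + 3) * 2 ^ (5 * (Nat.log 2 m + 1) ^ 2) ≤ 2 ^ (30 * (K + Nat.log 2 m ^ 2)) := by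
  set L := Nat.log 2 m with hL
  have hm : m < 2 ^ (L + 1) := Nat.lt_pow_succ_log_self one_lt_two m
  have hK2 : K < 2 ^ K := Nat.lt_two_pow_self
  have h1 : m * K + 3 ≤ 2 ^ (L + K + 3) := by
    have h3 : m * K ≤ 2 ^ (L + 1) * 2 ^ K := Nat.mul_le_mul hm.le hK2.le
    have h4 : 2 ^ (L + 1) * 2 ^ K = 2 ^ (L + K + 1) := by rw [← pow_add]; ring_nf
    have h5 : (3 : ℕ) ≤ 2 ^ (L + K + 1) := by
      calc (3 : ℕ) ≤ 2 ^ 2 := by norm_num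
        _ ≤ 2 ^ (L + K + 1) := Nat.pow_le_pow_right (by norm_num) (by omega)
    calc m * K + 3 ≤ 2 ^ (L + K + 1) + 2 ^ (L + K + 1) := by rw [h4] at h3; exact Nat.add_le_add h3 h5
      _ = 2 ^ (L + K + 2) := by rw [pow_succ]; ring
      _ ≤ 2 ^ (L + K + 3) := Nat.pow_le_pow_right (by norm_num) (by omega)
  have h2 : L + K + 3 + 5 * (L + 1) ^ 2 ≤ 30 * (K + L ^ 2) := by
    rcases Nat.eq_zero_or_pos L with h0 | hpos
    · rw [h0]; omega
    · nlinarith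
  calc (m * K + 3) * 2 ^ (5 * (L + 1) ^ 2) ≤ 2 ^ (L + K + 3) * 2 ^ (5 * (L + 1) ^ 2) := Nat.mul_le_mul_right _ h1
    _ = 2 ^ (L + K + 3 + 5 * (L + 1) ^ 2) := (pow_add _ _ _).symm
    _ ≤ 2 ^ (30 * (K + L ^ 2)) := Nat.pow_le_pow_right (by norm_num) h2

/-- **`TropicalB` ON THE HESSENBERG SECTOR (unsigned row form).**  Every Hessenberg design of format `(m, K)` satisfies the
unsigned row bound `DesignRowD d v ε (2^{30 (K + ⌊log₂ m⌋²)})`. [folklore: Gusfield 1980] -/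
theorem designRowD_hessenberg (d : Fin K → ℕ) (v ε : Fin m → Fin m → Fin K → ℤ) (hH : IsHessenberg ε) :
    DesignRowD d v ε (2 ^ (30 * (K + Nat.log 2 m ^ 2))) := by
  intro n θ p hθ hdom hne
  rcases Nat.eq_zero_or_pos K with hK | hK
  · -- no classes: no term at all unless `m = 0`, and then a single term
    subst hK
    rcases Nat.eq_zero_or_pos m with hm | hm
    · subst hm
      have hinj := injective_of_chainD d v ε θ p hθ hdom hne
      have hc := Fintype.card_le_of_injective p hinj
      simp only [Fintype.card_fin, Fintype.card_prod, Fintype.card_perm, Fintype.card_fun, Nat.factorial,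
        Nat.pow_zero, Nat.mul_one] at hc
      have hn : n = 0 := by omega
      subst hn
      exact Nat.zero_le _
    · exact Fin.elim0 ((p 0).2 ⟨0, hm⟩)
  · have h1 := chain_le_hessenberg hH θ p hθ hdom hne
    have h2 := size_le_two_pow m K hK
    omega

end IntervalOpt

open IntervalOpt in
/-- **`TropicalB` ON THE HESSENBERG SECTOR.**  There is an absolute `C` (`= 30`) such that for ALL `m, K`, every tropical
design of format `(m, K)` with Hessenberg support (`ε a b l ≠ 0 → a ≤ b + 1`: Leibniz terms = class-labelled interval
partitions = source–sink paths of a DAG) admits at most `2^{C (K + ⌊log₂ m⌋²)}` sign alternations along any strictly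
increasing integer parameter sequence of dominant terms — the statement of the crux `TropicalB` with the one extra hypothesis
`IsHessenberg ε`, in the window `log₂ m + 1 < K < m` included.  Gusfield's divide and conquer, not slope counting.
[folklore: Gusfield 1980; Carstensen 1983] -/
theorem tropicalB_hessenberg : ∃ C : ℕ, ∀ (m K : ℕ) (d : Fin K → ℕ) (v ε : Fin m → Fin m → Fin K → ℤ) (n : ℕ)
    (θ : Fin (n + 1) → ℤ) (p : Fin (n + 1) → Equiv.Perm (Fin m) × (Fin m → Fin K)),
    IsHessenberg ε → (∀ i j l, (ε i j l).natAbs ≤ 1) → StrictMono θ → (∀ k, IsDominant d v ε (θ k) (p k)) →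
    (∀ k : Fin n, termSign ε (p k.castSucc) * termSign ε (p k.succ) < 0) → n ≤ 2 ^ (C * (K + Nat.log 2 m ^ 2)) :=
  ⟨30, fun _ _ d v ε _ θ p hH _ hθ hdom halt =>
    designRowD_hessenberg d v ε hH _ θ p hθ hdom (ne_succ_of_alternating ε p halt)⟩

end Summit.ValiantsHypothesis.ValiantsHypothesis.Theorems.KPlusLogSqLaw
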